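import Summits.Parity.GeneralizedHardyLittlewood.Theorems.PrimeLevelFamEdgeMomentsBeyondDiagonalDiagDecorPrimeSqPrimeFourth
import Summits.Parity.GeneralizedHardyLittlewood.Theorems.PrimeLevelFamEdgeMomentsBeyondDiagonalDiagDecorPrimePowPeelTriple
import HarnessLib

/-!
# Route `PrimeLevelFamEdge`, crux K_A `MomentsBeyondDiagonal` (stmt-Parity-20007), line «petersson_layers» v4, stub `stub_diag`:
# **the `P₂²P₄`-decorated coprime Selberg sum: `Σ_{k≤y,(k,n)=1}τ(k)W(k)P₂(k)²P₄(k)logᶜ(y/k) = −9024·(c!/(c+6)!)·E_n·log^{c+6}y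
# + O(D(n)(1+κ(n))(1+log y)^{c+5})`** (`c ≥ 2`) — the third family of `M₈ = τ(105P₂⁴ − 420P₂²P₄ + 448P₂P₆ + 140P₄² − 272P₈)`

By the triple peel `…DiagDecorPrimePowPeelTriple.sum_copTauW_mul_primePow_triple_eq` (`m = m′ = 2`, `m″ = 4`) the sum is the
`P₈`-peel (`…DiagDecorPrimePowTwo.abs_coprimeSumPow_primePow_add_le_of_two_le 7`) plus three cross terms
(`…DiagDecorCross.abs_decorCross_sub_le`): outer `log⁴p` with inner `P₄` (`…PrimePowTwo … 3`), outer `log⁶p` with inner `P₂`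
(`…PrimePowTwo … 1`), outer `log²p` with inner `P₂P₄` (`…DiagDecorPrimeSqPrimeFourth`). The leading coefficient is left in the
closed factorial form the four inputs deliver (`= (10080 − 144 − 480 − 432)·c!/(c+6)! = 9024·c!/(c+6)!`, evaluated in the `M₈`
cancellation file):

* `abs_coprimeSumPow_primeSqSq_primeFourth_add_le` — **the displayed asymptotic**.

Def-free; theorems only. Helper `--supports stmt-Parity-20007`; closes nothing; K_A, K_B and the Parity summit are NOT proved;
nothing about Landau–Siegel zeros.

## References
* E. Kowalski, P. Michel, J. VanderKam, J. reine angew. Math. 526 (2000), (23)–(28) pp. 13–15 and Prop. 5.1 p. 18.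
  [cite: KowalskiMichelVanderKam2000, (23)–(28) — derivation (prime-power-log decorations of the Selberg coordinates)]
-/

noncomputable section

open scoped Real
open Finset ArithmeticFunction

namespace Summit.Parity.GeneralizedHardyLittlewood.Theorems.MomentsBeyondDiagonal.DiagKernel

open Literature.NumberTheory.LFunctions Literature.NumberTheory.LFunctions.KMV2000
open SelbergCoord (kappa)
open Summit.Parity.GeneralizedHardyLittlewood.Theorems.BeyondDiagonalBeatsQuarter.KernelFormXSq
  (copTauW mainConst divWeight divWeight_nonneg mainConst_nonneg)
open Summit.Parity.GeneralizedHardyLittlewood.Theorems.MomentsBeyondDiagonal.DiagLines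
  (sum_copTauW_mul_mul_sum_primeFactors_eq sum_copTauW_mul_primePow_triple_eq)

/-- Regrouping bookkeeping: `M₁ − (M₂ + M₃ + M₄) = M ⟹ A + X₁ + X₂ + X₃ + M = (A + M₁) + (X₁ − M₂) + (X₂ − M₃) + (X₃ − M₄)`.
[folklore] -/
private theorem regroup_four {A X₁ X₂ X₃ M₁ M₂ M₃ M₄ M : ℝ} (h : M₁ - (M₂ + M₃ + M₄) = M) :
    A + X₁ + X₂ + X₃ + M = (A + M₁) + (X₁ - M₂) + (X₂ - M₃) + (X₃ - M₄) := by
  rw [← h]; ring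

/-- `|a + b + c + d| ≤ |a| + |b| + |c| + |d|`. [folklore] -/
private theorem abs_add_four_le (a b c d : ℝ) : |a + b + c + d| ≤ |a| + |b| + |c| + |d| :=
  (abs_add_le _ _).trans (add_le_add ((abs_add_le _ _).trans (add_le_add (abs_add_le _ _) le_rfl)) le_rfl)

/-- **The `P₂²P₄`-decorated coprime Selberg sum** (`c ≥ 2`): there is `C` with, for all `n ≥ 1`, `y ≥ 1`,
`|Σ_{k≤y} a_n(k)·logᶜ(y/k)·P₂(k)²P₄(k) + (A₈ − X₄ − X₂ − X₂₄)·E_n·log^{c+6}y| ≤ C·D(n)(1+κ(n))(1+log y)^{c+5}` with the `P₈`-peel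
coefficient `A₈ = 2c(c−1)·7!(c−2)!/(c+6)!` and the cross coefficients `X₄ = 2(2c(c−1)3!(c−2)!/(c+2)!)(3!(c+2)!/(c+6)!)`,
`X₂ = 2(2c(c−1)1!(c−2)!/c!)(5!c!/(c+6)!)`, `X₂₄ = 2(216·c!/(c+4)!)(1!(c+4)!/(c+6)!)` (total `9024·c!/(c+6)!`).
[cite: KowalskiMichelVanderKam2000, (23)–(28) — derivation] -/
theorem abs_coprimeSumPow_primeSqSq_primeFourth_add_le {c : ℕ} (hc : 2 ≤ c) :
    ∃ C : ℝ, 0 < C ∧ ∀ n : ℕ, n ≠ 0 → ∀ y : ℝ, 1 ≤ y →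
      |∑ k ∈ Icc 1 ⌊y⌋₊, copTauW n k * Real.log (y / k) ^ c *
          ((∑ p ∈ k.primeFactors, Real.log p ^ 2) ^ 2 * ∑ p ∈ k.primeFactors, Real.log p ^ 4) +
          (2 * ((c : ℝ) * ((c : ℝ) - 1)) * (((Nat.factorial 7 : ℕ) : ℝ) * (c - 2).factorial / (c + 6).factorial) -
            (2 * (2 * ((c : ℝ) * ((c : ℝ) - 1)) * (((Nat.factorial 3 : ℕ) : ℝ) * (c - 2).factorial / (c + 2).factorial)) *
                (((Nat.factorial 3 : ℕ) : ℝ) * (c + 2).factorial / (c + 6).factorial) +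
              2 * (2 * ((c : ℝ) * ((c : ℝ) - 1)) * (((Nat.factorial 1 : ℕ) : ℝ) * (c - 2).factorial / (c).factorial)) *
                (((Nat.factorial 5 : ℕ) : ℝ) * (c).factorial / (c + 6).factorial) +
              2 * (216 * ((c.factorial : ℝ) / (c + 4).factorial)) *
                (((Nat.factorial 1 : ℕ) : ℝ) * (c + 4).factorial / (c + 6).factorial))) *
            mainConst n * Real.log y ^ (c + 6)| ≤
        C * divWeight n * (1 + kappa n) * (1 + Real.log y) ^ (c + 5) := by
  obtain ⟨C₈, hC₈, h₈⟩ := abs_coprimeSumPow_primePow_add_le_of_two_le 7 hc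
  obtain ⟨C₄, hC₄, h₄⟩ := abs_coprimeSumPow_primePow_add_le_of_two_le 3 hc
  obtain ⟨C₂, hC₂, h₂⟩ := abs_coprimeSumPow_primePow_add_le_of_two_le 1 hc
  obtain ⟨C₂₄, hC₂₄, h₂₄⟩ := abs_coprimeSumPow_primeSq_primeFourth_add_le hc
  rw [show c + 4 = c + 3 + 1 by ring] at h₂₄
  obtain ⟨C_A, hC_A, hXA⟩ := abs_decorCross_sub_le (fun k : ℕ ↦ ∑ p ∈ k.primeFactors, Real.log p ^ (3 + 1)) 3 (c - 2 + 3)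
    hC₄ h₄
  obtain ⟨C_B, hC_B, hXB⟩ := abs_decorCross_sub_le (fun k : ℕ ↦ ∑ p ∈ k.primeFactors, Real.log p ^ (1 + 1)) 5 (c - 2 + 1)
    hC₂ h₂
  obtain ⟨C_C, hC_C, hXC⟩ := abs_decorCross_sub_le
    (fun k : ℕ ↦ (∑ p ∈ k.primeFactors, Real.log p ^ 2) * ∑ p ∈ k.primeFactors, Real.log p ^ 4) 1 (c + 3) hC₂₄ h₂₄
  refine ⟨C₈ + C_A + C_B + C_C, by positivity, fun n hn y hy ↦ ?_⟩
  set N := ⌊y⌋₊ with hN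
  have hP := h₈ n hn y hy
  have hA := hXA n hn y hy
  have hB := hXB n hn y hy
  have hCx := hXC n hn y hy
  beta_reduce at hA hB hCx
  -- normalise the exponents
  have e8a : c - 2 + 7 + 1 = c + 6 := by omega
  have e8b : c - 2 + 7 = c + 5 := by omega
  rw [show ((7 : ℕ) + 1) = 8 from rfl, e8a, e8b] at hP
  have eA1 : c - 2 + 3 + 1 + 3 + 1 = c + 6 := by omega
  have eA2 : c - 2 + 3 + 1 + 3 = c + 5 := by omega
  have eA3 : c - 2 + 3 + 1 = c + 2 := by omega
  rw [show ((3 : ℕ) + 1) = 4 from rfl, eA1, eA2, eA3] at hA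
  have eB1 : c - 2 + 1 + 1 + 5 + 1 = c + 6 := by omega
  have eB2 : c - 2 + 1 + 1 + 5 = c + 5 := by omega
  have eB3 : c - 2 + 1 + 1 = c := by omega
  rw [show ((1 : ℕ) + 1) = 2 from rfl, show ((5 : ℕ) + 1) = 6 from rfl, eB1, eB2, eB3] at hB
  have eC1 : c + 3 + 1 + 1 + 1 = c + 6 := by omega
  have eC2 : c + 3 + 1 + 1 = c + 5 := by omega
  have eC3 : c + 3 + 1 = c + 4 := by omega
  rw [show ((1 : ℕ) + 1) = 2 from rfl, eC1, eC2, eC3] at hCx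
  -- decomposition `Σ aG·P₂²P₄ = P₈-peel + three cross terms`
  have hl : ∑ k ∈ Icc 1 N, copTauW n k * Real.log (y / k) ^ c *
      ((∑ p ∈ k.primeFactors, Real.log p ^ 2) ^ 2 * ∑ p ∈ k.primeFactors, Real.log p ^ 4) =
      ∑ k ∈ Icc 1 N, copTauW n k * Real.log (y / k) ^ c *
        ((∑ q ∈ k.primeFactors, Real.log q ^ 2) * ((∑ q ∈ k.primeFactors, Real.log q ^ 2) *
          ∑ q ∈ k.primeFactors, Real.log q ^ 4)) :=
    Finset.sum_congr rfl fun k _ ↦ by ring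
  have hpeel := sum_copTauW_mul_mul_sum_primeFactors_eq n N (fun k : ℕ ↦ Real.log (y / k) ^ c)
    (fun p : ℕ ↦ Real.log p ^ 8)
  have htri := sum_copTauW_mul_primePow_triple_eq n N 2 2 4 (fun k : ℕ ↦ Real.log (y / k) ^ c)
  beta_reduce at hpeel htri
  rw [show 2 + 2 + 4 = 8 from rfl, show 2 + 2 = 4 from rfl, show 2 + 4 = 6 from rfl, ← hpeel] at htri
  rw [hl, htri]
  rw [regroup_four (M₁ := 2 * ((c : ℝ) * ((c : ℝ) - 1)) * (((Nat.factorial 7 : ℕ) : ℝ) * (c - 2).factorial / (c + 6).factorial) *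
      mainConst n * Real.log y ^ (c + 6))
    (M₂ := 2 * (2 * ((c : ℝ) * ((c : ℝ) - 1)) * (((Nat.factorial 3 : ℕ) : ℝ) * (c - 2).factorial / (c + 2).factorial)) *
      (((Nat.factorial 3 : ℕ) : ℝ) * (c + 2).factorial / (c + 6).factorial) * mainConst n * Real.log y ^ (c + 6))
    (M₃ := 2 * (2 * ((c : ℝ) * ((c : ℝ) - 1)) * (((Nat.factorial 1 : ℕ) : ℝ) * (c - 2).factorial / (c).factorial)) *
      (((Nat.factorial 5 : ℕ) : ℝ) * (c).factorial / (c + 6).factorial) * mainConst n * Real.log y ^ (c + 6))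
    (M₄ := 2 * (216 * ((c.factorial : ℝ) / (c + 4).factorial)) *
      (((Nat.factorial 1 : ℕ) : ℝ) * (c + 4).factorial / (c + 6).factorial) * mainConst n * Real.log y ^ (c + 6))
    (by ring)]
  refine ((abs_add_four_le _ _ _ _).trans (add_le_add (add_le_add (add_le_add hP hA) hB) hCx)).trans_eq ?_
  ring

end Summit.Parity.GeneralizedHardyLittlewood.Theorems.MomentsBeyondDiagonal.DiagKernel

end
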